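import Literature.MathematicalPhysics.QuantumFieldTheory.Balaban1983to89.Node00.BgRemainderOfRecord
import Literature.MathematicalPhysics.QuantumFieldTheory.Balaban1983to89.B11Eq98W80Composite
import HarnessLib

/-!
# [B11] Prop. 4 (97)–(98) pp.292–293 AT THE SCHEME OF RECORD — THE (R2) TARGET LETTER `Prop4UniformAtRecord` («`(δ∕δA′)V` quadratic-analytic
# with `C₄, a₃` depending on d and L only») AND ITS J5′ READING «displayed letters ⇒ target» over lit ✓`quadAnalytic_W80_composite`
# — OURS (a target letter + glue; the letters are DISPLAYED, nothing of Bałaban proved here)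

Cell `pub-ymgap`, unit `pub-ymgap-node00-def-Y` (g37; owner∕custodian of the `OpsY` instance at the record; Node00 definition lane;
count-neutral, `--supports stmt-QuantumFields-27238`).  ★★★ director-ym №556 (c) ∕ №557: slot №2 of the porter pool := (R2)-UNIFORM = the
`RegimeTok` input «`QuadAnalytic (WOfRecordAt …) C₄ a₃` with `C₄, a₃` uniform in k (and volume)» of 3i′ `bgSchemeOfRecord_regimeTok_of(_print)`;
node00-def-Y types the TARGET first (this file), the porter hand (★ PTB-1) lands the letter DISCHARGES against it by name.

WHAT THIS FILE DOES (and does not).  The print: *«Proposition 4. … The functional derivative of V(A′) is an analytic function on this space, and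
satisfies the estimate |((δ∕δA′)V)(A′)| < C₄ε₃²(Lʲη)⁻³ on Ω_j … (97) The constants a₃, C₄ depend on d and L only. The above estimate can be
formulated also in the following way: |((δ∕δA′)V)(A′)|₍₋₃₎ ≦ C₄(max{|A′|₍₋₁₎, |∇A′|₍₋₂₎})², (98) and it is valid if max{…} ≦ a₃.»* (p.293).
Lit has ASSEMBLED (98) for its object `W80` from displayed termwise letters: ✓`B11Eq98W80Composite.quadAnalytic_W80_composite` (conclusion
`QuadAnalytic (W80 ρ τ U₀ H C εC J Δπ) C₄ᶜ R′ ∧ AnalyticOnNhd …`, `C₄ᶜ` an explicit polynomial in the letters).  Since 3f′'s `WOfRecordAt` IS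
`W80` at the record's slots (`WOfRecordAt_eq`, `rfl`), the record-level assembly is ONE application of that theorem — glue.  So:
§1 **`Prop4UniformAtRecord … C₄ R′ : Prop := QuadAnalytic (WOfRecordAt …) C₄ R′`** — THE TARGET LETTER (= 3i′'s hypothesis `hW` by `Iff.rfl`);
   **`Prop4LettersAtRecord … : Prop`** — the DISPLAYED INPUT LETTERS of Prop. 4 at the record, = the hypotheses of ✓`quadAnalytic_W80_composite`
   read at the record's slots, grouped (ℓa) Sect. C regime of `CslOfRecord` + `Prop4Hyp` ((44)–(46); needs the slot-(a) bound `‖H₁(U₀)‖ ≤ b`,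
   an (R1)-class letter), (ℓb) the V₀-group quadratic bound at `unitsOfRecord U₀` ((90)–(96); lit ✓`B11Eq98V0LettersLatticeUniform`), (ℓc) the
   (27)-symmetry of `Δπ` of record (Summit-side ✓`…N07DeltaPiOfRecordPairing`), (ℓd) the composite letters `N₁`, `θ_E`, `θ_E′`, `θ₃` ((86)–(89);
   lit ✓`B11Eq88LaplaceH1Current{Letter,Norm,Column}`, ✓`B11Eq88KernelColumnsComposite`), (ℓe) the radii bookkeeping.
§2 ★ **`prop4UniformAtRecord_of_letters`** — «letters ⇒ target» with the EXPLICIT constant `c4OfRecord` (PROVED: `WOfRecordAt` is `W80`, one call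
   of ✓`quadAnalytic_W80_composite`); `analyticOnNhd_WOfRecordAt_of_letters` (the second conjunct); `prop4UniformAtRecord_mono` (raise `C₄`).
«UNIFORM IN k» is carried by PROVENANCE: `c4OfRecord` is a fixed polynomial in `‖ρ‖, ‖τ‖, ‖J‖` and the letter constants, so it is k-free exactly
when the hand discharges (ℓa)–(ℓd) with k-free constants (functions of d, L, N and the named [B9] inputs) — as lit's `…LatticeUniform` ∕
`…LatticeFree` files do; a Summit-side `∃ C₄ R′, ∀ k, …` wrapper is the consumer's (DEF-1 ∕ ▶ PTA-1) when read.
HONEST: a target letter, a displayed-letters letter and glue; (ℓa)–(ℓd) are NOT discharged here; (R1) («Thm 3.13 of [5]») untouched; nothing of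
[B9]∕[B11]'s estimates is proved in this file.  No instance, no notation, no `set_option`.
-/

noncomputable section

open scoped Matrix Matrix.Norms.L2Operator InnerProductSpace ComplexConjugate

namespace Literature.MathematicalPhysics.QuantumFieldTheory.Balaban1983to89.Node00

open T4Continuum (T4Family)
open B4Sect5Torus (TSite)
open B9SectCLatticeCarrier (Bond)
open B11Eq103H1Complex (BondL2K SiteL2K)
open B11Eq115Space (Space115 NegSize NegSup JetSup levWeight)
open B11Eq111FrakG (nabla115)
open B11Eq90Transpose (single115 kernel)
open B11Eq90V0primeCurrent (flat115)
open B11Eq63V0GroupCurrent (curV0)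
open B11Eq80Current (Emap E3 W80)
open B13Contraction113 (QuadAnalytic)
open B11Prop6Scheme (Prop4Hyp)
open B11Eq174Chart (Regime)
open B11Eq98W80Composite (quadAnalytic_W80_composite)

section Generic

/-! ## §1 Lit's Prop. 4 input letters for `W80`, NAMED ONE BY ONE (abstract carriers — verbatim the binders of ✓`quadAnalytic_W80_composite`) -/

variable {𝔸 : Type*} [NormedRing 𝔸] [NormedAlgebra ℂ 𝔸] [FiniteDimensional ℂ 𝔸] [CompleteSpace 𝔸]
variable {d : ℕ} {Pd : Fin d → ℕ} {L η : ℝ} [Fact (0 < L)] [Fact (0 < η)] {lev₀ : Bond d Pd → ℕ} {κ' : Type*} [Fintype κ']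
  {lev₁ : κ' → ℕ} {Dc : (Bond d Pd → 𝔸) →ₗ[ℂ] (κ' → 𝔸)}
variable {𝒳 : Type*} [NormedAddCommGroup 𝒳] [NormedSpace ℂ 𝒳] [CompleteSpace 𝒳]

/-- ★ **THE EXPLICIT CONSTANT `C₄` OF PROP. 4** in the letter constants — lit ✓`quadAnalytic_W80_composite`'s polynomial, as a function of the slots
`ρ τ` (through `‖ρ‖ ‖τ‖`), a size `nJ` for `‖J‖` and the letter constants. [cite: Balaban1985Variational, Prop. 4 p.293 («The constants a₃, C₄ depend on d and L only»)] -/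
def c4OfLetters (ρ : (𝔸 →L[ℂ] ℂ) →L[ℂ] 𝔸) (τ : 𝔸 →L[ℂ] ℂ) (nJ b C₂ εC aC CV R' θ₃ θE θE' N₁ : ℝ) : ℝ :=
  (‖ρ‖ * ‖τ‖ * θ₃ * nJ + (N₁ * C₂ * (1 / (1 - 4 * b * C₂ * (εC + aC))) ^ 2 + ‖ρ‖ * ‖τ‖ * θE')
    + ‖ρ‖ * ‖τ‖ * θE * (N₁ * C₂ * (1 / (1 - 4 * b * C₂ * (εC + aC))) ^ 2) * R'
    + ‖ρ‖ * ‖τ‖ * (1 + θE * R') * CV * (1 / (1 - 4 * b * C₂ * (εC + aC))) ^ 2)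

omit [FiniteDimensional ℂ 𝔸] [CompleteSpace 𝔸] in
/-- `c4OfLetters` is monotone in the size `nJ` of `J` (given `0 ≤ θ₃`) — so `‖J‖ ≤ C₁B₃ε₁` (3d′ ✓`norm_JOfRecordAtBg_le`) yields a k-free majorant.
[cite: Balaban1985Variational, Prop. 4 p.293 (bookkeeping)] -/
theorem c4OfLetters_mono_nJ (ρ : (𝔸 →L[ℂ] ℂ) →L[ℂ] 𝔸) (τ : 𝔸 →L[ℂ] ℂ) {nJ nJ' b C₂ εC aC CV R' θ₃ θE θE' N₁ : ℝ} (hθ₃ : 0 ≤ θ₃)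
    (h : nJ ≤ nJ') : c4OfLetters ρ τ nJ b C₂ εC aC CV R' θ₃ θE θE' N₁ ≤ c4OfLetters ρ τ nJ' b C₂ εC aC CV R' θ₃ θE θE' N₁ := by
  unfold c4OfLetters
  have hρ : 0 ≤ ‖ρ‖ := norm_nonneg ρ
  have hτ : 0 ≤ ‖τ‖ := norm_nonneg τ
  have : ‖ρ‖ * ‖τ‖ * θ₃ * nJ ≤ ‖ρ‖ * ‖τ‖ * θ₃ * nJ' :=
    mul_le_mul_of_nonneg_left h (mul_nonneg (mul_nonneg hρ hτ) hθ₃)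
  linarith

/-- (ℓa-H) **THE BOUND ON `H` (slot (a))**: `‖H X‖ ≤ b‖X‖` — [B9] (3.132)∕[B11] (117)'s `B₀`-class letter. DISPLAYED. [cite: Balaban1985Variational, (45) p.285, (117) p.295] -/
def Prop4LetterH (H : 𝒳 →L[ℂ] Space115 L η lev₀ lev₁ Dc) (b : ℝ) : Prop :=
  ∀ X : 𝒳, ‖H X‖ ≤ b * ‖X‖

/-- (ℓb) **THE V₀-GROUP QUADRATIC BOUND**: `‖curV0 ρ τ U₀ Y‖ ≤ CV‖Y‖²` on `‖Y‖ < RV` ((90)–(96); lit ✓`curV0_quadBound_lattice_uniform`). DISPLAYED.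
[cite: Balaban1985Variational, (90)–(96) pp.291–292] -/
def Prop4LetterV0 (ρ : (𝔸 →L[ℂ] ℂ) →L[ℂ] 𝔸) (τ : 𝔸 →L[ℂ] ℂ) (U₀ : Bond d Pd → 𝔸ˣ) (CV RV : ℝ) : Prop :=
  0 ≤ CV ∧ ∀ Y : Space115 L η lev₀ lev₁ Dc, ‖Y‖ < RV → ‖curV0 (lev₁ := lev₁) (Dc := Dc) ρ τ U₀ Y‖ ≤ CV * ‖Y‖ ^ 2

/-- (ℓc) **THE (27)-SYMMETRY OF `Δπ`** in the raw-sum spelling of ✓`quadAnalytic_W80_composite` (`pair27` form: lit ✓`B11Eq90Transpose.pair27_eq_sum`).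
DISPLAYED (hypothesis-free at the record: ✓`DeltaPiCurOfRecord_pairSum_comm`). [cite: Balaban1985Variational, (27) p.282] -/
def Prop4LetterSymm (τ : 𝔸 →L[ℂ] ℂ) (Δπ : Space115 L η lev₀ lev₁ Dc →L[ℂ] NegSize L η lev₀ 3 𝔸) : Prop :=
  ∀ Y₁ Y₂ : Space115 L η lev₀ lev₁ Dc,
    ∑ b' : Bond d Pd, τ (NegSup.equiv (levWeight L η lev₀ 3) 𝔸 (Δπ Y₁) b' * flat115 Y₂ b') =
      ∑ b' : Bond d Pd, τ (NegSup.equiv (levWeight L η lev₀ 3) 𝔸 (Δπ Y₂) b' * flat115 Y₁ b')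

/-- (ℓd) **THE COMPOSITE LETTER `N₁` AND THE COLUMN LETTERS `θ_E`, `θ_E′`, `θ₃`** of `Δπ∘H`, `fderiv (Emap H C εC)`, `fderiv (E3 H C εC)` on `‖A′‖ < R′`, with
their signs — verbatim the binders `hN₁ hΘE hΘ' hΘ3` of ✓`quadAnalytic_W80_composite` ([B9] (3.132), [B11] (55), (73), (86)–(89)). DISPLAYED.
[cite: Balaban1985Variational, (86)–(89) p.291, (55) p.286, (73) p.289] -/
def Prop4LetterColumns (H : 𝒳 →L[ℂ] Space115 L η lev₀ lev₁ Dc) (C : Space115 L η lev₀ lev₁ Dc → 𝒳) (εC : ℝ)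
    (Δπ : Space115 L η lev₀ lev₁ Dc →L[ℂ] NegSize L η lev₀ 3 𝔸) (R' θ₃ θE θE' N₁ : ℝ) : Prop :=
  (0 ≤ θ₃ ∧ 0 ≤ θE ∧ 0 ≤ θE' ∧ 0 ≤ N₁) ∧
  (∀ X : 𝒳, ‖Δπ (H X)‖ ≤ N₁ * ‖X‖) ∧
  (∀ A' : Space115 L η lev₀ lev₁ Dc, ‖A'‖ < R' → ∀ bb : Bond d Pd, ∑ b' : Bond d Pd,
    levWeight L η lev₀ 3 bb / levWeight L η lev₀ 3 b' * ‖kernel (fderiv ℂ (Emap H C εC) A') b' bb‖ ≤ θE * ‖A'‖) ∧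
  (∀ A' : Space115 L η lev₀ lev₁ Dc, ‖A'‖ < R' → ∀ (bb : Bond d Pd) (X : 𝔸), ∑ b' : Bond d Pd,
    levWeight L η lev₀ 3 bb / levWeight L η lev₀ 1 b'
      * ‖NegSup.equiv (levWeight L η lev₀ 3) 𝔸 (Δπ ((fderiv ℂ (Emap H C εC) A') (single115 bb X))) b'‖ ≤ θE' * ‖A'‖ * ‖X‖) ∧
  (∀ A' : Space115 L η lev₀ lev₁ Dc, ‖A'‖ < R' → ∀ bb : Bond d Pd, ∑ b' : Bond d Pd,
    levWeight L η lev₀ 3 bb / levWeight L η lev₀ 3 b' * ‖kernel (fderiv ℂ (E3 H C εC) A') b' bb‖ ≤ θ₃ * ‖A'‖ ^ 2)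

/-- (ℓa-num)∕(ℓe) **THE SCALAR CONDITIONS** — the Sect. C regime's numbers for `(b, C₂, c₄, aC, εC)` («Thm 3.13»-free: `0 ≤ b, C₂, εC`, `2(εC + aC) ≤ c₄`,
`bC₂(εC + aC)² ≤ εC`, `4bC₂(εC + aC) < 1`) and the radii `0 ≤ R′ ≤ aC`, `R′ ≤ (1 − 4bC₂(εC + aC))·RV`.  Pure arithmetic the hand DISCHARGES by choosing
`εC aC R′` as explicit terms in `(b, C₂, c₄, RV)`. [cite: Balaban1985Variational, (46) p.285, Prop. 3 p.289, (118)–(121) p.295] -/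
def Prop4LetterNum (b C₂ c₄ aC εC RV R' : ℝ) : Prop :=
  0 ≤ b ∧ 0 ≤ C₂ ∧ 0 ≤ εC ∧ 2 * (εC + aC) ≤ c₄ ∧ b * C₂ * (εC + aC) ^ 2 ≤ εC ∧ 4 * b * C₂ * (εC + aC) < 1 ∧
    0 ≤ R' ∧ R' ≤ aC ∧ R' ≤ (1 - 4 * b * C₂ * (εC + aC)) * RV

omit [FiniteDimensional ℂ 𝔸] [CompleteSpace 𝔸] [CompleteSpace 𝒳] in
/-- **The Sect. C regime from (ℓa-H), (ℓa-C) and the numbers** (`θ = 0`, `j = 0`; as lit ✓`Regime.of_normBound_zeroLinear`).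
[cite: Balaban1985Variational, (46) p.285, Prop. 3 p.289] -/
theorem regimeC_of_letters {H : 𝒳 →L[ℂ] Space115 L η lev₀ lev₁ Dc} {C : Space115 L η lev₀ lev₁ Dc → 𝒳} {b C₂ c₄ aC εC RV R' : ℝ}
    (hH : Prop4LetterH H b) (hC : Prop4Hyp C C₂ c₄) (hnum : Prop4LetterNum b C₂ c₄ aC εC RV R') :
    Regime H (0 : Space115 L η lev₀ lev₁ Dc →L[ℂ] Space115 L η lev₀ lev₁ Dc) C b 0 C₂ c₄ 0 aC εC := by
  obtain ⟨hb, hC₂, hεC, hdom, hself, hcontr, -, -, -⟩ := hnum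
  exact ⟨hH, fun Y => by simp, hC.quadAnalytic, hb, hC₂, le_rfl, hεC, hdom, by simpa using hself, by simpa using hcontr⟩

/-- ★ **«LETTERS ⇒ PROP. 4 (97)–(98)» FOR `W80` WITH THE CONSTANT `c4OfLetters ρ τ ‖J‖ …` ON THE RADIUS `R′`** — one application of lit
✓`quadAnalytic_W80_composite` (both members: `QuadAnalytic` and analyticity on the open ball).  Glue. [cite: Balaban1985Variational, Prop. 4 (97)–(98) pp.292–293] -/
theorem quadAnalytic_W80_of_letters (ρ : (𝔸 →L[ℂ] ℂ) →L[ℂ] 𝔸) (τ : 𝔸 →L[ℂ] ℂ) (U₀ : Bond d Pd → 𝔸ˣ) {H : 𝒳 →L[ℂ] Space115 L η lev₀ lev₁ Dc}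
    {C : Space115 L η lev₀ lev₁ Dc → 𝒳} {εC : ℝ} (J : NegSize L η lev₀ 3 𝔸) (Δπ : Space115 L η lev₀ lev₁ Dc →L[ℂ] NegSize L η lev₀ 3 𝔸)
    {b C₂ c₄ aC CV RV R' θ₃ θE θE' N₁ : ℝ} (hH : Prop4LetterH H b) (hC : Prop4Hyp C C₂ c₄) (hnum : Prop4LetterNum b C₂ c₄ aC εC RV R')
    (hV : Prop4LetterV0 (L := L) (η := η) (lev₀ := lev₀) (lev₁ := lev₁) (Dc := Dc) ρ τ U₀ CV RV) (hsym : Prop4LetterSymm τ Δπ)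
    (hcol : Prop4LetterColumns H C εC Δπ R' θ₃ θE θE' N₁) :
    QuadAnalytic (W80 ρ τ U₀ H C εC J Δπ) (c4OfLetters ρ τ ‖J‖ b C₂ εC aC CV R' θ₃ θE θE' N₁) R' ∧
      AnalyticOnNhd ℂ (W80 ρ τ U₀ H C εC J Δπ) {Y : Space115 L η lev₀ lev₁ Dc | ‖Y‖ < R'} := by
  have RC := regimeC_of_letters hH hC hnum
  obtain ⟨-, -, -, -, -, -, hR'0, hR'a, hR'V⟩ := hnum
  obtain ⟨hCV, hqV⟩ := hV
  obtain ⟨⟨hθ₃, hθE, hθE', hN₁0⟩, hN₁, hΘE, hΘ', hΘ3⟩ := hcol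
  exact quadAnalytic_W80_composite ρ τ U₀ hCV hqV RC hC J Δπ hsym hθ₃ hθE hθE' hN₁0 hR'0 hR'a hR'V hN₁ hΘE hΘ' hΘ3

end Generic

section Record

variable (F : T4Family) (N : ℕ) [NeZero N] (K k : ℕ) (Ω : ℕ → Set (Site (F.P K) 0)) (U₀ : GaugeField (F.P K) 0 (SU N))
variable [Fact (0 < (F.L : ℝ))] [Fact (0 < (F.P K).eta k)] [Fact (0 < c0Rec F K k)] [Fact (∀ c, 0 < wBRec F K k c)]

/-! ## §2 At the scheme of record: the target letter, the named input letters, and «letters ⇒ target» -/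

/-- ★ **THE (R2) TARGET LETTER `Prop4UniformAtRecord`** — [B11] Prop. 4 (97)–(98) for the scheme of record's `W := WOfRecordAt … εC Gp`: «`(δ∕δA′)V` is
quadratic-analytic on `max{|A′|₍₋₁₎, |∇A′|₍₋₂₎} < R′` with constant `C₄`» AND «is an analytic function on this space» (both members of lit's :179, as
★ PTB-1 asked).  Member 1 = the hypothesis `hW` of 3i′ `bgSchemeOfRecord_regimeTok_of` (`prop4UniformAtRecord_quadAnalytic`); member 2 = M2-ℂ's
`WAnalyticTok` at radius `R′`.  `εC C₄ R′` are PARAMETERS — «uniform in k» = the hand produces them as k-free closed terms.  DISPLAYED.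
[cite: Balaban1985Variational, Prop. 4 (97)–(98) pp.292–293] -/
def Prop4UniformAtRecord (levB : PBond (F.P K) k → ℕ) (a : ℝ)
    (hpos : ∀ x, x ≠ 0 → 0 < RCLike.re ⟪x, laplaceAOfRecord F N k U₀ (QOfRecord F N k U₀) (QflatOfRecord F N k) a x⟫_ℂ)
    (hQ : Function.Surjective (QOfRecord F N k U₀)) (εC : ℝ)
    (Gp : SiteL2K ℂ (F.P K).d (fun _ => (F.P K).sitesPerDir 0) (c0Rec F K k) (WRec N) →ₗ[ℂ]
      SiteL2K ℂ (F.P K).d (fun _ => (F.P K).sitesPerDir 0) (c0Rec F K k) (WRec N)) (C₄ R' : ℝ) : Prop :=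
  QuadAnalytic (WOfRecordAt F N K k Ω U₀ levB a hpos hQ εC Gp) C₄ R' ∧
    AnalyticOnNhd ℂ (WOfRecordAt F N K k Ω U₀ levB a hpos hQ εC Gp) {Y : Space115Lit F N K k Ω U₀ | ‖Y‖ < R'}

/-- (ℓa-H) at the record: `‖H₁(U₀) X‖ ≤ b‖X‖` for `H := H1OfRecordAtBgFlat … levB a hpos♭ hQ` — the (R1)-class letter ((117) `B₀` ∕ «Thm 3.13 of [5]»).
DISPLAYED. [cite: Balaban1985Variational, (45) p.285, (117) p.295] -/
def Prop4LetterHAtRecord (levB : PBond (F.P K) k → ℕ) (a : ℝ)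
    (hpos : ∀ x, x ≠ 0 → 0 < RCLike.re ⟪x, laplaceAOfRecord F N k U₀ (QOfRecord F N k U₀) (QflatOfRecord F N k) a x⟫_ℂ)
    (hQ : Function.Surjective (QOfRecord F N k U₀)) (b : ℝ) : Prop :=
  Prop4LetterH (H1OfRecordAtBgFlat F N K k Ω U₀ levB a hpos hQ) b

/-- (ℓa-C) at the record: `Prop4Hyp (CslOfRecord … levB) C₂ c₄` — (44) «`|C(A′)| ≤ C₂|A′|²`» + analyticity on `‖A′‖ < c₄` for 3e′∕3f′'s `C^{𝔰𝔩}`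
(Fréchet form; ⟹ `QuadAnalytic` by lit ✓`Prop4Hyp.quadAnalytic`).  DISPLAYED — 3e′ asserts no (44) constant; the hand's discharge carries the
background guard (`SmallBelow …` ∕ the polydisc letter). [cite: Balaban1985Variational, (44) p.285, (49) p.285] -/
def Prop4LetterCAtRecord (levB : PBond (F.P K) k → ℕ) (C₂ c₄ : ℝ) : Prop :=
  Prop4Hyp (CslOfRecord F N K k Ω U₀ levB) C₂ c₄

/-- (ℓb) at the record: the V₀-group bound for `curV0 (rhoRec N) (tauRecCLM N) (unitsOfRecord F N U₀)` on `Space115Lit`. DISPLAYED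
(discharge candidate: lit ✓`curV0_quadBound_lattice_uniform`, modulo the `‖τ‖` rescaling ★ PTB-1 located). [cite: Balaban1985Variational, (90)–(96) pp.291–292] -/
def Prop4LetterV0AtRecord (CV RV : ℝ) : Prop :=
  Prop4LetterV0 (L := (F.L : ℝ)) (η := (F.P K).eta k) (lev₀ := bondLevLit F Ω k) (lev₁ := pairLevLit F Ω k)
    (Dc := nabla115 ((F.P K).eta k) (unitsOfRecord F N U₀)) (rhoRec N) (tauRecCLM N) (unitsOfRecord F N U₀) CV RV

/-- (ℓc) at the record: the (27)-symmetry of `DeltaPiCurOfRecord … Gp Q′♭` (raw-sum spelling).  DISPLAYED — hypothesis-free at every background by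
✓`DeltaPiCurOfRecord_pairSum_comm` (Summit-side; cancel `η^d ≠ 0`). [cite: Balaban1985Variational, (27) p.282] -/
def Prop4LetterSymmAtRecord
    (Gp : SiteL2K ℂ (F.P K).d (fun _ => (F.P K).sitesPerDir 0) (c0Rec F K k) (WRec N) →ₗ[ℂ]
      SiteL2K ℂ (F.P K).d (fun _ => (F.P K).sitesPerDir 0) (c0Rec F K k) (WRec N)) : Prop :=
  Prop4LetterSymm (tauRecCLM N) (DeltaPiCurOfRecord F N K k Ω U₀ Gp (QflatOfRecord F N k))

/-- (ℓd) at the record: `N₁`, `θ_E`, `θ_E′`, `θ₃` for `H := H1OfRecordAtBgFlat …`, `C := CslOfRecord …`, `εC`, `Δπ := DeltaPiCurOfRecord … Gp Q′♭` on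
`‖A′‖ < R′`.  DISPLAYED ([B9] (3.132)-class; record ports = (R1)-class). [cite: Balaban1985Variational, (86)–(89) p.291] -/
def Prop4LetterColumnsAtRecord (levB : PBond (F.P K) k → ℕ) (a : ℝ)
    (hpos : ∀ x, x ≠ 0 → 0 < RCLike.re ⟪x, laplaceAOfRecord F N k U₀ (QOfRecord F N k U₀) (QflatOfRecord F N k) a x⟫_ℂ)
    (hQ : Function.Surjective (QOfRecord F N k U₀)) (εC : ℝ)
    (Gp : SiteL2K ℂ (F.P K).d (fun _ => (F.P K).sitesPerDir 0) (c0Rec F K k) (WRec N) →ₗ[ℂ]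
      SiteL2K ℂ (F.P K).d (fun _ => (F.P K).sitesPerDir 0) (c0Rec F K k) (WRec N)) (R' θ₃ θE θE' N₁ : ℝ) : Prop :=
  Prop4LetterColumns (H1OfRecordAtBgFlat F N K k Ω U₀ levB a hpos hQ) (CslOfRecord F N K k Ω U₀ levB) εC
    (DeltaPiCurOfRecord F N K k Ω U₀ Gp (QflatOfRecord F N k)) R' θ₃ θE θE' N₁

/-- ★ **THE CONSTANT `C₄` OF RECORD AT A SIZE `nJ` OF `J`** := `c4OfLetters (rhoRec N) (tauRecCLM N) nJ …` — a closed term in `‖ρ‖ ‖τ‖`, `nJ` and the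
letter constants (k-free by provenance; `nJ := C₁B₃ε₁` under the (14) window by 3d′ ✓`norm_JOfRecordAtBg_le`). [cite: Balaban1985Variational, Prop. 4 p.293] -/
def c4OfRecord (nJ b C₂ εC aC CV R' θ₃ θE θE' N₁ : ℝ) : ℝ :=
  c4OfLetters (rhoRec N) (tauRecCLM N) nJ b C₂ εC aC CV R' θ₃ θE θE' N₁

/-- ★★ **PROP. 4 AT THE RECORD FROM ITS NAMED LETTERS** — «(ℓa-H) → (ℓa-C) → (ℓa-num) → (ℓb) → (ℓc) → (ℓd) ⇒ `Prop4UniformAtRecord … εC Gp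
(c4OfRecord ‖J‖ …) R′`», PROVED: `WOfRecordAt` IS lit's `W80` at the record's slots (3f′ `WOfRecordAt_eq`, `rfl`), so this is `quadAnalytic_W80_of_letters`.
The J5′ reading of slot №2: the hand lands the LETTERS by name; this line turns them into 3i′'s `hW` and M2-ℂ's `WAnalyticTok`.  HONEST: glue.
[cite: Balaban1985Variational, Prop. 4 (97)–(98) pp.292–293] -/
theorem prop4UniformAtRecord_of_letters (levB : PBond (F.P K) k → ℕ) (a : ℝ)
    (hpos : ∀ x, x ≠ 0 → 0 < RCLike.re ⟪x, laplaceAOfRecord F N k U₀ (QOfRecord F N k U₀) (QflatOfRecord F N k) a x⟫_ℂ)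
    (hQ : Function.Surjective (QOfRecord F N k U₀)) {εC : ℝ}
    (Gp : SiteL2K ℂ (F.P K).d (fun _ => (F.P K).sitesPerDir 0) (c0Rec F K k) (WRec N) →ₗ[ℂ]
      SiteL2K ℂ (F.P K).d (fun _ => (F.P K).sitesPerDir 0) (c0Rec F K k) (WRec N))
    {b C₂ c₄ aC CV RV R' θ₃ θE θE' N₁ : ℝ}
    (hH : Prop4LetterHAtRecord F N K k Ω U₀ levB a hpos hQ b) (hC : Prop4LetterCAtRecord F N K k Ω U₀ levB C₂ c₄)
    (hnum : Prop4LetterNum b C₂ c₄ aC εC RV R') (hV : Prop4LetterV0AtRecord F N K k Ω U₀ CV RV) (hsym : Prop4LetterSymmAtRecord F N K k Ω U₀ Gp)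
    (hcol : Prop4LetterColumnsAtRecord F N K k Ω U₀ levB a hpos hQ εC Gp R' θ₃ θE θE' N₁) :
    Prop4UniformAtRecord F N K k Ω U₀ levB a hpos hQ εC Gp
      (c4OfRecord N ‖JOfRecordAtBg F N K k Ω U₀‖ b C₂ εC aC CV R' θ₃ θE θE' N₁) R' :=
  quadAnalytic_W80_of_letters (rhoRec N) (tauRecCLM N) (unitsOfRecord F N U₀) (JOfRecordAtBg F N K k Ω U₀)
    (DeltaPiCurOfRecord F N K k Ω U₀ Gp (QflatOfRecord F N k)) hH hC hnum hV hsym hcol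

/-- **Raising the constant**: `Prop4UniformAtRecord` is monotone in `C₄`. [cite: Balaban1985Variational, Prop. 4 p.293 (bookkeeping)] -/
theorem prop4UniformAtRecord_mono (levB : PBond (F.P K) k → ℕ) (a : ℝ)
    (hpos : ∀ x, x ≠ 0 → 0 < RCLike.re ⟪x, laplaceAOfRecord F N k U₀ (QOfRecord F N k U₀) (QflatOfRecord F N k) a x⟫_ℂ)
    (hQ : Function.Surjective (QOfRecord F N k U₀)) (εC : ℝ)
    (Gp : SiteL2K ℂ (F.P K).d (fun _ => (F.P K).sitesPerDir 0) (c0Rec F K k) (WRec N) →ₗ[ℂ]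
      SiteL2K ℂ (F.P K).d (fun _ => (F.P K).sitesPerDir 0) (c0Rec F K k) (WRec N)) {C₄ C₄' R' : ℝ}
    (h : Prop4UniformAtRecord F N K k Ω U₀ levB a hpos hQ εC Gp C₄ R') (hle : C₄ ≤ C₄') :
    Prop4UniformAtRecord F N K k Ω U₀ levB a hpos hQ εC Gp C₄' R' :=
  ⟨⟨fun Y hY => (h.1.quad Y hY).trans (mul_le_mul_of_nonneg_right hle (sq_nonneg _)), h.1.lineAnalytic⟩, h.2⟩

/-- ★★ **THE SAME WITH `‖J‖` REPLACED BY A BOUND `nJ`** (`‖JOfRecordAtBg …‖ ≤ nJ`, e.g. `nJ := C₁B₃ε₁` from 3d′ ✓`norm_JOfRecordAtBg_le` under the (14)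
window) — the k-free form the hand lands. [cite: Balaban1985Variational, Prop. 4 p.293, (28) p.282] -/
theorem prop4UniformAtRecord_of_letters_of_norm_J_le (levB : PBond (F.P K) k → ℕ) (a : ℝ)
    (hpos : ∀ x, x ≠ 0 → 0 < RCLike.re ⟪x, laplaceAOfRecord F N k U₀ (QOfRecord F N k U₀) (QflatOfRecord F N k) a x⟫_ℂ)
    (hQ : Function.Surjective (QOfRecord F N k U₀)) {εC : ℝ}
    (Gp : SiteL2K ℂ (F.P K).d (fun _ => (F.P K).sitesPerDir 0) (c0Rec F K k) (WRec N) →ₗ[ℂ]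
      SiteL2K ℂ (F.P K).d (fun _ => (F.P K).sitesPerDir 0) (c0Rec F K k) (WRec N))
    {b C₂ c₄ aC CV RV R' θ₃ θE θE' N₁ nJ : ℝ}
    (hH : Prop4LetterHAtRecord F N K k Ω U₀ levB a hpos hQ b) (hC : Prop4LetterCAtRecord F N K k Ω U₀ levB C₂ c₄)
    (hnum : Prop4LetterNum b C₂ c₄ aC εC RV R') (hV : Prop4LetterV0AtRecord F N K k Ω U₀ CV RV) (hsym : Prop4LetterSymmAtRecord F N K k Ω U₀ Gp)
    (hcol : Prop4LetterColumnsAtRecord F N K k Ω U₀ levB a hpos hQ εC Gp R' θ₃ θE θE' N₁) (hJ : ‖JOfRecordAtBg F N K k Ω U₀‖ ≤ nJ) :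
    Prop4UniformAtRecord F N K k Ω U₀ levB a hpos hQ εC Gp (c4OfRecord N nJ b C₂ εC aC CV R' θ₃ θE θE' N₁) R' :=
  prop4UniformAtRecord_mono F N K k Ω U₀ levB a hpos hQ εC Gp
    (prop4UniformAtRecord_of_letters F N K k Ω U₀ levB a hpos hQ Gp hH hC hnum hV hsym hcol)
    (c4OfLetters_mono_nJ (rhoRec N) (tauRecCLM N) hcol.1.1 hJ)

/-- Member 1: the target letter gives 3i′'s hypothesis `hW : QuadAnalytic (WOfRecordAt …) C₄ R′`. [cite: Balaban1985Variational, Prop. 4 (98) p.293 (bookkeeping)] -/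
theorem prop4UniformAtRecord_quadAnalytic (levB : PBond (F.P K) k → ℕ) (a : ℝ)
    (hpos : ∀ x, x ≠ 0 → 0 < RCLike.re ⟪x, laplaceAOfRecord F N k U₀ (QOfRecord F N k U₀) (QflatOfRecord F N k) a x⟫_ℂ)
    (hQ : Function.Surjective (QOfRecord F N k U₀)) (εC : ℝ)
    (Gp : SiteL2K ℂ (F.P K).d (fun _ => (F.P K).sitesPerDir 0) (c0Rec F K k) (WRec N) →ₗ[ℂ]
      SiteL2K ℂ (F.P K).d (fun _ => (F.P K).sitesPerDir 0) (c0Rec F K k) (WRec N)) {C₄ R' : ℝ}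
    (h : Prop4UniformAtRecord F N K k Ω U₀ levB a hpos hQ εC Gp C₄ R') :
    QuadAnalytic (WOfRecordAt F N K k Ω U₀ levB a hpos hQ εC Gp) C₄ R' :=
  h.1

/-- Member 2: `W` of record is analytic on the open ball `‖Y‖ < R′` (M2-ℂ's `WAnalyticTok` at radius `R′`).
[cite: Balaban1985Variational, Prop. 4 p.293 («is an analytic function on this space»)] -/
theorem prop4UniformAtRecord_analyticOnNhd (levB : PBond (F.P K) k → ℕ) (a : ℝ)
    (hpos : ∀ x, x ≠ 0 → 0 < RCLike.re ⟪x, laplaceAOfRecord F N k U₀ (QOfRecord F N k U₀) (QflatOfRecord F N k) a x⟫_ℂ)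
    (hQ : Function.Surjective (QOfRecord F N k U₀)) (εC : ℝ)
    (Gp : SiteL2K ℂ (F.P K).d (fun _ => (F.P K).sitesPerDir 0) (c0Rec F K k) (WRec N) →ₗ[ℂ]
      SiteL2K ℂ (F.P K).d (fun _ => (F.P K).sitesPerDir 0) (c0Rec F K k) (WRec N)) {C₄ R' : ℝ}
    (h : Prop4UniformAtRecord F N K k Ω U₀ levB a hpos hQ εC Gp C₄ R') :
    AnalyticOnNhd ℂ (WOfRecordAt F N K k Ω U₀ levB a hpos hQ εC Gp) {Y : Space115Lit F N K k Ω U₀ | ‖Y‖ < R'} :=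
  h.2

end Record

end Literature.MathematicalPhysics.QuantumFieldTheory.Balaban1983to89.Node00

end
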